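import Mathlib
import Summits.Ventures.PercRepro2.Defs
import Summits.Ventures.PercRepro2.Independence
import Summits.Ventures.PercRepro2.Harris
import Summits.Ventures.PercRepro2.Graph
import Summits.Ventures.PercRepro2.Exploration
import Summits.Ventures.PercRepro2.Events
import Summits.Ventures.PercRepro2.FourFunctions
import Summits.Ventures.PercRepro2.Induced
import Summits.Ventures.PercRepro2.Frontier
import Summits.Ventures.PercRepro2.ObsIndependence
import Summits.Ventures.PercRepro2.BHK
import Summits.Ventures.PercRepro2.BHKEvents
import Summits.Ventures.PercRepro2.MultiSource
import Summits.Ventures.PercRepro2.OrderPreservation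
import Summits.Ventures.PercRepro2.SeedSet
import Summits.Ventures.PercRepro2.MultiSourceFun
import Summits.Ventures.PercRepro2.CrossRootT
import Summits.Ventures.PercRepro2.VdBKahn
import Summits.Ventures.PercRepro2.HullDefs
import Summits.Ventures.PercRepro2.CCTRootEdge
import Summits.Ventures.PercRepro2.CCTAvoidedEdge
import Summits.Ventures.PercRepro2.R1Rung
import Summits.Ventures.PercRepro2.CC2Rung
import Summits.Ventures.PercRepro2.PASubDefs
import Summits.Ventures.PercRepro2.HalfN
import Summits.Ventures.PercRepro2.CCTLin
import Summits.Ventures.PercRepro2.L1SDefs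
import Summits.Ventures.PercRepro2.L1SDel
import Summits.Ventures.PercRepro2.L1S

/-!
# Row 2′CCT-LIN, the two-set linearised rung (L1-CC2) and its reduction to (CC2) (blind cell
PercRepro2, typer-1; mine-c g3 MINE-C.md §10.7 (a) "the linearisation DOES extend to BHK's two-set
shape — with the diagonal inner structure": `Ã_Z` with `Z = X ∩ Y` in BOTH factors, the `F, G`
masses intact; census n = 5/6/7 0 violations)

With avoided sets `X, Y`, `Z = X ∩ Y`, and the S-frame's linearised joint mass
`Ã_Z = linJoint p ends e s (X ∩ Y) a b`:

* **`L1CC2`**: `0 ≤ Ã_Z (P₀^{X∪Y})² − P₀^{X∪Y} (F₀ˣ G₁ʸ + F₁ˣ G₀ʸ) + F₀ˣ G₀ʸ P₁^{X∪Y}` — (CC2) with `Ã_Z`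
  in place of the joint mass `A₁^Z = F₁ᵃᵇ(Z)`; closure `L1CC2_all`;
* `L1S_iff_L1CC2_diag`: on the diagonal `X = Y = T` it is (L1-S);
* **`CC2_of_L1CC2`**: `(L1-CC2) ⟹ (CC2)` — immediate from `linJoint_le` (`Ã_Z ≤ A₁^Z`, BHK 1.3 for the
  merge cluster in `G − S` with the single avoided set `Z`), the S-frame analogue of mine-c's
  "verified 0 violations" inequality, now a theorem.
-/

namespace Summit.Ventures.PercRepro2

namespace SFrame

open PASub CCTLin TwoSetRung

open scoped Classical

variable {V : Type*} {E : Type*} [Fintype E] [DecidableEq E] [Fintype V] [DecidableEq V]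
  {R : Type*} [Field R] [LinearOrder R] [IsStrictOrderedRing R]

section Rows

variable (p : E → R) (ends : E → Sym2 V) (e : E) (s : V) (X Y : Finset V)

/-- **(L1-CC2)** (mine-c §10.7 (a)), cleared by `(P₀^{X∪Y})²`:
`0 ≤ Ã_{X∩Y} (P₀^{X∪Y})² − P₀^{X∪Y} (F₀ˣ G₁ʸ + F₁ˣ G₀ʸ) + F₀ˣ G₀ʸ P₁^{X∪Y}`. -/
def L1CC2 (a b : V) : Prop :=
  0 ≤ linJoint p ends e s (X ∩ Y) a b * massP (Function.update p e 0) ends s (X ∪ Y) ^ 2 -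
      massP (Function.update p e 0) ends s (X ∪ Y) *
        (massF (Function.update p e 0) ends s {a} X * massF (Function.update p e 1) ends s {b} Y +
          massF (Function.update p e 1) ends s {a} X * massF (Function.update p e 0) ends s {b} Y) +
      massF (Function.update p e 0) ends s {a} X * massF (Function.update p e 0) ends s {b} Y *
        massP (Function.update p e 1) ends s (X ∪ Y)

omit [IsStrictOrderedRing R] in
/-- On the diagonal `X = Y = T`, (L1-CC2) is (L1-S). -/
lemma L1S_iff_L1CC2_diag (T : Finset V) (a b : V) :
    L1S p ends e s T a b ↔ L1CC2 p ends e s T T a b := by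
  unfold L1S L1CC2
  rw [Finset.inter_self, Finset.union_self]

end Rows

section Closure

variable (R : Type*) [Field R] [LinearOrder R] [IsStrictOrderedRing R]

/-- (L1-CC2) over all finite graphs, admissible weights, edges, roots, avoided pairs and targets. -/
def L1CC2_all : Prop :=
  ∀ (V E : Type) [Fintype V] [DecidableEq V] [Fintype E] [DecidableEq E]
    (ends : E → Sym2 V) (p : E → R), IsProbVec p →
    ∀ (e : E) (s : V) (X Y : Finset V) (a b : V), s ∉ X → s ∉ Y → L1CC2 p ends e s X Y a b

end Closure

section Reduction

variable (p : E → R) (ends : E → Sym2 V) (e : E) (s : V) (X Y : Finset V)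

/-- **(L1-CC2) ⟹ (CC2)**: the two-set linearisation implies BHK's two-set rung
`TwoSetRung.CC2 p ends e s {a} {b} X Y`, by `Ã_{X∩Y} ≤ A₁^{X∩Y}` (`linJoint_le`). -/
theorem CC2_of_L1CC2 (hp : IsProbVec p) (a b : V) (h : L1CC2 p ends e s X Y a b) :
    CC2 p ends e s {a} {b} X Y := by
  unfold CC2
  rw [massF_update_one_pair_eq]
  unfold L1CC2 at h
  have hle := linJoint_le p ends e s (X ∩ Y) hp a b
  have hP2 : 0 ≤ massP (Function.update p e 0) ends s (X ∪ Y) ^ 2 := sq_nonneg _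
  nlinarith [h, mul_le_mul_of_nonneg_right hle hP2]

end Reduction

end SFrame

end Summit.Ventures.PercRepro2
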